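import Summits.BirchSwinnertonDyer.BirchSwinnertonDyer.Theorems.EisensteinPrimesFullDescentKummerSplitting
import Summits.BirchSwinnertonDyer.BirchSwinnertonDyer.Theorems.CumulativeHeegnerLeopoldtCumulativeHeegnerInclusionAtThreeStubResidualSelmerFiniteLineDeterminant
import Summits.BirchSwinnertonDyer.Rank1Residual.X2.TateLineDecomposition
import Literature.NumberTheory.EllipticCurves.GoodReductionUnramifiedProofs
import Literature.NumberTheory.EllipticCurves.GaloisActionProofs
import Literature.NumberTheory.GaloisRepresentations.HeckeCharacterProofs
import HarnessLib

/-!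
# Route `EisensteinPrimes`, crux 2 `GoodLatticeBDPValue` (stmt-BirchSwinnertonDyer-19032), line `halves` v21, stub 3a-B
# `stub_fullDescentAtThreeOfRed`, brick F8 (Theorem B, «Case 𝟙 ⇒ Case ω»): **a curve `E/ℚ` with a rational point `P` of
# order `3`, `E[3]` unramified-by-lines at the bad primes `≠ 3` and a moving `D₃`-stable line at `3`, carries a RATIONAL
# `μ₃`-LINE: `E[3] ≅ 𝟙 ⊕ μ₃`**

Cell `bsd-eis` (home `run/shared/lean/pub/bsd-eis/`), width seat `bsd-line-x1-p1-w2` (gen 5; `--supports -19032`, closes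
nothing by itself). Step B1–B3 of the AN-3 road memo `HOME/line-x1-p1-w3-g4/AN3-StubB-elementary-road.md` §2: the Kummer
splitting lemma (`FullDescentKummerSplitting.exists_stable_complement`, this seat, UNCONDITIONAL) at `(L, N, M) = (0, ⟨P⟩, E[3])`.
Hypotheses, all dischargeable from landed bricks: `P ∈ E[3]`, `P ≠ 0`, fixed by `Γ_ℚ`; at every place `v ∤ 3` either good
reduction (Néron–Ogg–Shafarevich, tree `smul_eq_of_mem_inertia_of_nsmul_eq_zero`) or a line `X ≤ E[3]` fixed pointwise
by ONE inertia group above `v` and MOVED by some element of `Γ_ℚ` (the Tate line `μ₃` at a split multiplicative `ℓ ≡ 2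
(mod 3)`: bricks F1/F2 of w3 gen 4) — then `E[3] = ⟨P⟩ ⊕ X` is inertia-trivial; at the place `v₃ ∣ 3` a `D₃`-stable line
`Λ ≤ E[3]` not fixed pointwise by `Γ_ℚ` (the ordinary line, moved by inertia: bricks F3) — then `Λ ⊓ ⟨P⟩ = 0`; the
quotient character is `χ̄₃` by the determinant (chl cell's `smul_sub_nsmul_mem_of_smul_sub_eq`).

* **`exists_omegaLine_of_fixed_point`** — conclusion: a `Γ_ℚ`-stable `C ≤ E[3]` of order `3` with `C ⊓ ⟨P⟩ = ⊥` on which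
  `Γ_ℚ` acts through `χ̄₃` (`σ x = χ̄₃(σ) x`).

HONEST FRAMING: helper theorem only (0 definitions, 0 named facts, 0 sorry); no summit statement, no BSD / IMC2 /
Keller–Yin theorem, no stub of the registered skeleton is proved here. References: [SilvermanAEC2009] VIII §1–2;
[SerreInventiones1972] §1.11–1.12; [Mazur1978] §5.
-/

set_option autoImplicit false
-- the route's Theorems namespace repeats the summit name by design (D-0017 nested layout)
set_option linter.dupNamespace false

noncomputable section

open scoped Classical NumberField

namespace Summit.BirchSwinnertonDyer.BirchSwinnertonDyer.Theorems.FullDescentCaseOne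

open Function NumberField IsDedekindDomain Field Rat.HeightOneSpectrum WeierstrassCurve
  Literature.NumberTheory.GaloisRepresentations Literature.NumberTheory.EllipticCurves
  Summit.BirchSwinnertonDyer.Rank1Residual.X2.ResidualDevissageModules
  Summit.BirchSwinnertonDyer.BirchSwinnertonDyer.Theorems.FullDescentKummerSplitting
  Summit.BirchSwinnertonDyer.BirchSwinnertonDyer.Theorems.CumulativeHeegnerInclusionAtThreeStubB1LineDeterminant

/-- **Theorem B of the AN-3 road («Case 𝟙 ⇒ Case ω»): a rational point of order `3` plus local unramifiedness forces a
rational `μ₃`-line in `E[3]`.** `W/ℚ` elliptic, `P ∈ E[3]`, `P ≠ 0`, `σ P = P` for all `σ ∈ Γ_ℚ`; at every place `v ∤ 3`: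
good reduction, or a line `X ≤ E[3]` (`#X = 3`) fixed pointwise by the inertia group of some prime `𝔓 ∣ v` of `\bar ℤ` and
whose non-zero points are all moved by one `δ ∈ Γ_ℚ`; at `v₃ ∣ 3`: a `D₃`-stable line `Λ ≤ E[3]` (`#Λ = 3`,
`GreenbergSelmer.decomp v₃`-stable) not fixed pointwise by `Γ_ℚ`. Then there is a `Γ_ℚ`-stable `C ≤ E[3]` of order `3`,
meeting `⟨P⟩` trivially, on which every `σ ∈ Γ_ℚ` acts as `χ̄₃(σ)`.
[cite: SilvermanAEC2009, VIII §2 (Kummer theory for E[m])] [cite: SerreInventiones1972, §1.11–1.12] -/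
theorem exists_omegaLine_of_fixed_point (W : WeierstrassCurve ℚ) [W.IsElliptic]
    {P : geomTorsion W ((3 : ℕ) : ℤ)} (hP0 : P ≠ 0) (hP : ∀ σ : absoluteGaloisGroup ℚ, σ • P = P)
    (hloc : ∀ v : HeightOneSpectrum (𝓞 ℚ), natGenerator v ≠ 3 → W.HasGoodReductionAt v ∨
      ∃ 𝔓 ∈ v.primesAbove, ∃ X : AddSubgroup (geomTorsion W ((3 : ℕ) : ℤ)), Nat.card X = 3 ∧
        (∀ τ ∈ 𝔓.inertia (absoluteGaloisGroup ℚ), ∀ x ∈ X, τ • x = x) ∧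
        ∃ δ : absoluteGaloisGroup ℚ, ∀ x ∈ X, x ≠ 0 → δ • x ≠ x)
    {v₃ : HeightOneSpectrum (𝓞 ℚ)} (hv₃ : natGenerator v₃ = 3)
    (h3 : ∃ Λ : AddSubgroup (geomTorsion W ((3 : ℕ) : ℤ)), Nat.card Λ = 3 ∧
      (∀ δ ∈ GreenbergSelmer.decomp (K := ℚ) v₃, ∀ x ∈ Λ, δ • x ∈ Λ) ∧
      ¬ ∀ σ : absoluteGaloisGroup ℚ, ∀ x ∈ Λ, σ • x = x) :
    ∃ C : AddSubgroup (geomTorsion W ((3 : ℕ) : ℤ)), Nat.card C = 3 ∧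
      (∀ σ : absoluteGaloisGroup ℚ, ∀ x ∈ C, σ • x ∈ C) ∧ C ⊓ AddSubgroup.zmultiples P = ⊥ ∧
      ∀ σ : absoluteGaloisGroup ℚ, ∀ x ∈ C,
        σ • x = ((modNCyclotomicCharacter ℚ 3 σ : (ZMod 3)ˣ) : ZMod 3).val • x := by
  haveI : Fact (Nat.Prime 3) := ⟨Nat.prime_three⟩
  set Φ : AddSubgroup (geomTorsion W ((3 : ℕ) : ℤ)) := AddSubgroup.zmultiples P with hΦdef
  -- ### orders: `P` has order `3`, `#Φ = 3`, `#E[3] = 9`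
  have h3P : ((3 : ℕ) : ℤ) • P = 0 := by
    apply Subtype.ext
    have h := (mem_torsionPoints_iff _ _ (P : geomPoints W)).mp P.2
    rwa [natCast_zsmul] at h ⊢
  have hPord : addOrderOf P = 3 := by
    have hdvd : addOrderOf P ∣ 3 := addOrderOf_dvd_of_nsmul_eq_zero (by rwa [natCast_zsmul] at h3P)
    rcases (Nat.dvd_prime Nat.prime_three).mp hdvd with h1 | h1
    · exact absurd (AddMonoid.addOrderOf_eq_one_iff.mp h1) hP0
    · exact h1
  have hΦcard : Nat.card Φ = 3 := by rw [hΦdef, Nat.card_zmultiples, hPord]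
  have hVcard : Nat.card (geomTorsion W ((3 : ℕ) : ℤ)) = 9 := by
    have h : Nat.card (geomTorsion W ((3 : ℕ) : ℤ)) = 3 ^ 2 :=
      card_torsionBy_eq_sq (E := W.baseChange (AlgebraicClosure ℚ)) (n := 3) (by norm_num)
    rw [h]; norm_num
  have hΦfix : ∀ (σ : absoluteGaloisGroup ℚ), ∀ x ∈ Φ, σ • x = x := by
    intro σ x hx
    obtain ⟨k, rfl⟩ := AddSubgroup.mem_zmultiples_iff.mp hx
    have h1 : σ • (k • P) = k • (σ • P) := map_zsmul (DistribSMul.toAddMonoidHom _ σ) k P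
    rw [h1, hP σ]
  -- a line not pointwise fixed meets `Φ` trivially
  have hmeet : ∀ Y : AddSubgroup (geomTorsion W ((3 : ℕ) : ℤ)), Nat.card Y = 3 → (¬ ∀ σ : absoluteGaloisGroup ℚ, ∀ x ∈ Y, σ • x = x) →
      Y ⊓ Φ = ⊥ := by
    intro Y hY hYfix
    rcases Rank1Residual.X2.TateLineDecomposition.inf_eq_bot_or_eq W 3 hY hΦcard with h | h
    · exact h
    · exact absurd (fun σ x hx ↦ hΦfix σ x (h ▸ hx)) hYfix
  -- ### the quotient character is `χ̄₃` (determinant on the fixed line)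
  let S : StableSubgroup (absoluteGaloisGroup ℚ) (geomTorsion W ((3 : ℕ) : ℤ)) := ⟨Φ, fun g _ hm ↦ by rw [hΦfix g _ hm]; exact hm⟩
  have hScard : Nat.card S.Sub = 3 := hΦcard
  have hω : ∀ (σ : absoluteGaloisGroup ℚ), ∀ x ∈ (⊤ : AddSubgroup (geomTorsion W ((3 : ℕ) : ℤ))),
      σ • x - (((modNCyclotomicCharacter ℚ 3 σ : (ZMod 3)ˣ) : ZMod 3).val : ℤ) • x ∈ Φ := by
    intro σ x _
    have h := smul_sub_nsmul_mem_of_smul_sub_eq W 3 S hScard σ 1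
      ((modNCyclotomicCharacter ℚ 3 σ : (ZMod 3)ˣ) : ZMod 3).val
      (by rw [ZMod.natCast_zmod_val, Nat.cast_one, one_mul])
      (fun m ↦ by rw [one_smul]; exact Subtype.ext (hΦfix σ m.1 m.2)) x
    rwa [natCast_zsmul]
  -- ### apply the Kummer splitting lemma at `(⊥, Φ, ⊤)`
  obtain ⟨Λ, hΛcard, hΛst, hΛfix⟩ := h3
  have hbot : Nat.card (⊥ : AddSubgroup (geomTorsion W ((3 : ℕ) : ℤ))) = 1 := AddSubgroup.card_bot
  have htop : Nat.card (⊤ : AddSubgroup (geomTorsion W ((3 : ℕ) : ℤ))) = 9 * 1 := by rw [AddSubgroup.card_top, hVcard]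
  have h3x : ∀ x : geomTorsion W ((3 : ℕ) : ℤ), (3 : ℤ) • x = 0 := fun x ↦ by
    apply Subtype.ext
    have h := (mem_torsionPoints_iff _ _ (x : geomPoints W)).mp x.2
    rw [AddSubgroupClass.coe_zsmul, ZeroMemClass.coe_zero]
    exact_mod_cast h
  -- the hypotheses of the splitting lemma, one by one
  have hLst : ∀ (σ : absoluteGaloisGroup ℚ), ∀ x ∈ (⊥ : AddSubgroup (geomTorsion W ((3 : ℕ) : ℤ))), σ • x ∈ (⊥ : AddSubgroup _) :=
    fun σ x hx ↦ by rw [(AddSubgroup.mem_bot).mp hx, smul_zero]; exact AddSubgroup.mem_bot.mpr rfl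
  have h3mem : ∀ x ∈ (⊤ : AddSubgroup (geomTorsion W ((3 : ℕ) : ℤ))), (3 : ℤ) • x ∈ (⊥ : AddSubgroup _) :=
    fun x _ ↦ by rw [AddSubgroup.mem_bot]; exact h3x x
  have hAfix : ∀ (σ : absoluteGaloisGroup ℚ), ∀ x ∈ Φ, σ • x - x ∈ (⊥ : AddSubgroup (geomTorsion W ((3 : ℕ) : ℤ))) :=
    fun σ x hx ↦ by rw [hΦfix σ x hx, sub_self]; exact AddSubgroup.mem_bot.mpr rfl
  have hcont : ∀ x ∈ (⊤ : AddSubgroup (geomTorsion W ((3 : ℕ) : ℤ))),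
      IsOpen ((MulAction.stabilizer (absoluteGaloisGroup ℚ) x : Subgroup (absoluteGaloisGroup ℚ)) :
        Set (absoluteGaloisGroup ℚ)) := by
    intro x _
    have h := isOpen_stabilizer_point_holds W (x : geomPoints W)
    have heq : ((MulAction.stabilizer (absoluteGaloisGroup ℚ) x : Subgroup (absoluteGaloisGroup ℚ)) :
        Set (absoluteGaloisGroup ℚ)) = (MulAction.stabilizer (absoluteGaloisGroup ℚ) (x : geomPoints W) : Set _) := by
      ext σ
      simp only [SetLike.mem_coe, MulAction.mem_stabilizer_iff]
      rw [← Subtype.coe_inj, AddSubgroup.torsionBy.coe_smul]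
    rw [heq]; exact h
  have hunr : ∀ v : HeightOneSpectrum (𝓞 ℚ), natGenerator v ≠ 3 →
      ∃ 𝔓 ∈ v.primesAbove, ∀ τ ∈ 𝔓.inertia (absoluteGaloisGroup ℚ),
        ∀ x ∈ (⊤ : AddSubgroup (geomTorsion W ((3 : ℕ) : ℤ))), τ • x - x ∈ (⊥ : AddSubgroup _) := by
    intro v hv
    have hv3 : ((3 : ℕ) : 𝓞 ℚ) ∉ v.asIdeal := by
      rw [Rat.natCast_mem_asIdeal_iff, Nat.prime_dvd_prime_iff_eq (prime_natGenerator v) Nat.prime_three]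
      exact hv
    rcases hloc v hv with hgood | ⟨𝔓, h𝔓, X, hXcard, hXfix, δ, hδ⟩
    · refine ⟨adicCompletionPrime ℚ v, adicCompletionPrime_mem_primesAbove ℚ v, fun τ hτ x _ ↦ ?_⟩
      rw [AddSubgroup.mem_bot, sub_eq_zero]
      apply Subtype.ext
      rw [AddSubgroup.torsionBy.coe_smul]
      refine W.smul_eq_of_mem_inertia_of_nsmul_eq_zero hgood hv3 (adicCompletionPrime_mem_primesAbove ℚ v) hτ ?_
      have h := (mem_torsionPoints_iff _ _ (x : geomPoints W)).mp x.2
      rwa [natCast_zsmul] at h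
    · refine ⟨𝔓, h𝔓, fun τ hτ x _ ↦ ?_⟩
      -- `E[3] = X ⊔ Φ` (two distinct lines), both fixed pointwise by `τ`
      have hXΦ : X ⊓ Φ = ⊥ := hmeet X hXcard fun hall ↦ by
        obtain ⟨y, hy, hy0⟩ : ∃ y ∈ X, y ≠ 0 := by
          by_contra hnone
          push Not at hnone
          have : X = ⊥ := (AddSubgroup.eq_bot_iff_forall _).mpr hnone
          rw [this, AddSubgroup.card_bot] at hXcard
          exact absurd hXcard (by norm_num)
        exact hδ y hy hy0 (hall δ y hy)
      haveI : Finite (geomTorsion W ((3 : ℕ) : ℤ)) := Nat.finite_of_card_ne_zero (by rw [hVcard]; norm_num)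
      have hsup : X ⊔ Φ = ⊤ := by
        have hle : Nat.card (X ⊔ Φ : AddSubgroup (geomTorsion W ((3 : ℕ) : ℤ))) ∣ 9 := by
          rw [← hVcard]; exact AddSubgroup.card_addSubgroup_dvd_card _
        have hX3 : 3 ∣ Nat.card (X ⊔ Φ : AddSubgroup (geomTorsion W ((3 : ℕ) : ℤ))) := by
          have h := AddSubgroup.card_dvd_of_le (le_sup_left : X ≤ X ⊔ Φ)
          rwa [hXcard] at h
        have hne : Nat.card (X ⊔ Φ : AddSubgroup (geomTorsion W ((3 : ℕ) : ℤ))) ≠ 3 := fun h3' ↦ by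
          have hXeq : X = X ⊔ Φ := AddSubgroup.eq_of_le_of_card_ge le_sup_left (by rw [h3', hXcard])
          have hΦle : Φ ≤ X := by rw [hXeq]; exact le_sup_right
          have hΦbot : Φ = ⊥ := by rw [← inf_eq_right.mpr hΦle, hXΦ]
          rw [hΦbot, AddSubgroup.card_bot] at hΦcard
          exact absurd hΦcard (by norm_num)
        have h9 : Nat.card (X ⊔ Φ : AddSubgroup (geomTorsion W ((3 : ℕ) : ℤ))) = 9 := by
          obtain ⟨k, hk, hk'⟩ := (Nat.dvd_prime_pow Nat.prime_three).mp
            (show Nat.card (X ⊔ Φ : AddSubgroup (geomTorsion W ((3 : ℕ) : ℤ))) ∣ 3 ^ 2 by simpa using hle)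
          interval_cases k
          · rw [hk'] at hX3; exact absurd hX3 (by norm_num)
          · exact absurd hk' hne
          · simpa using hk'
        exact AddSubgroup.eq_top_of_card_eq _ (by rw [h9, hVcard])
      have hx : x ∈ X ⊔ Φ := by rw [hsup]; exact AddSubgroup.mem_top x
      obtain ⟨y, hy, z, hz, rfl⟩ := AddSubgroup.mem_sup.mp hx
      rw [AddSubgroup.mem_bot, smul_add, hXfix τ hτ y hy, hΦfix τ z hz, sub_self]
  have hspl : ∃ B₃ : AddSubgroup (geomTorsion W ((3 : ℕ) : ℤ)), ⊥ ≤ B₃ ∧ B₃ ≤ ⊤ ∧ Nat.card B₃ = 3 * 1 ∧ B₃ ⊓ Φ = ⊥ ∧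
      ∀ δ ∈ GreenbergSelmer.decomp (K := ℚ) v₃, ∀ x ∈ B₃, δ • x ∈ B₃ :=
    ⟨Λ, bot_le, le_top, by simpa using hΛcard, hmeet Λ hΛcard hΛfix, hΛst⟩
  obtain ⟨B, -, -, hBΦ, hΦB, hBst⟩ := exists_stable_complement (V := geomTorsion W ((3 : ℕ) : ℤ)) ⊥ Φ ⊤ bot_le le_top
    one_ne_zero hbot (by simpa using hΦcard) htop hLst h3mem hAfix hω hcont hunr hv₃ hspl
  -- ### read off the complement
  have hBcard : Nat.card B = 3 := by
    haveI : Finite (geomTorsion W ((3 : ℕ) : ℤ)) := Nat.finite_of_card_ne_zero (by rw [hVcard]; norm_num)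
    have hdvd : Nat.card B ∣ 9 := hVcard ▸ AddSubgroup.card_addSubgroup_dvd_card B
    obtain ⟨k, hk, hk'⟩ := (Nat.dvd_prime_pow Nat.prime_three).mp (show Nat.card B ∣ 3 ^ 2 by simpa using hdvd)
    interval_cases k
    · exfalso
      have hB : B = ⊥ := AddSubgroup.eq_bot_of_card_eq B (by simpa using hk')
      rw [hB, sup_bot_eq] at hΦB
      rw [hΦB, AddSubgroup.card_top, hVcard] at hΦcard
      norm_num at hΦcard
    · simpa using hk'
    · exfalso
      have hB : B = ⊤ := AddSubgroup.eq_top_of_card_eq B (by rw [hVcard]; simpa using hk')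
      rw [hB, top_inf_eq] at hBΦ
      rw [hBΦ, AddSubgroup.card_bot] at hΦcard
      norm_num at hΦcard
  refine ⟨B, hBcard, hBst, hBΦ, fun σ x hx ↦ ?_⟩
  have h1 : σ • x - ((modNCyclotomicCharacter ℚ 3 σ : (ZMod 3)ˣ) : ZMod 3).val • x ∈ B ⊓ Φ :=
    ⟨B.sub_mem (hBst σ x hx) (B.nsmul_mem hx _), by
      have h := hω σ x (AddSubgroup.mem_top x); rwa [natCast_zsmul] at h⟩
  rw [hBΦ, AddSubgroup.mem_bot, sub_eq_zero] at h1
  exact h1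

end Summit.BirchSwinnertonDyer.BirchSwinnertonDyer.Theorems.FullDescentCaseOne

end
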